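import Mathlib.RepresentationTheory.Invariants
import Mathlib.LinearAlgebra.FiniteDimensional.Lemmas
import HarnessLib

/-!
# Venture HSemireg — the INVARIANT-PART LAW for an equivariant semiregularity map with trivially acted target
# (twisted sheaves on gerbes over an abelian anchor = `G̃`-equivariant sheaves on an isogenous cover)

HONEST FRAMING. Lean index of the computation cell `pub-hsemireg`, widening seat `w1-tw-1` (W1, «twisted sheaves on
gerbes over the CM anchors»). This file is ELEMENTARY LINEAR ALGEBRA (the Reynolds / averaging operator of a finite
group whose order is invertible in the coefficient ring — Maschke's trick; folklore). No gerbe, no sheaf, no Atiyah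
class and no semiregularity map is constructed here; nothing here says that HC, HC_CM or HC_AV holds, and nothing here is
a new case of anything. What the file turns into kernel statements is the bookkeeping step of the seat's note
`run/shared/lean/pub/pub-hsemireg/widen/W1/TW-EQ-w1tw1.md` (THEOREM TW-EQ (iii)–(iv)):

*Geometric reading (on paper, NOT in this file).* Let `A₀` be a complex abelian variety, `α ∈ Br(A₀)` ANY Brauer class,
`θ ∈ H²(A₀, μ_n)` a lift. A Heisenberg Azumaya representative `𝒜_θ ≅ ⊕_{χ ∈ Ĝ} P_χ` exists (flat projective bundle of the
central extension of `π₁(A₀) = Λ` defined by `θ`), and pulling back along the isogeny `p : A₁ → A₀` dual to `Ĝ ⊂ Pic⁰(A₀)`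
gives an equivalence «`α`-twisted coherent sheaves `E` on `A₀`» ≃ «coherent sheaves `N` on `A₁` with a `G̃`-linearisation
of central weight `1`», `G = ker p` acting on `A₁` by TRANSLATIONS, `G̃` its Heisenberg extension by `μ_n`; under it
`Extⁱ_α(E,E) = Extⁱ_{A₁}(N,N)^G` and the (Buchweitz–Flenner / Pridham) semiregularity map of `E` is the restriction of
`σ_N : Ext²(N,N) → ⊕_q H^{q+2}(A₁, Ω^q)` to the invariants. The ONE input that makes the present file relevant:
translations act TRIVIALLY on `H^{q+2}(A₁, Ω^q)` (they are homotopic to the identity and holomorphic), while `σ_N` is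
`G̃`-equivariant by naturality of the Atiyah class. Hence `σ_N` is a `G`-equivariant linear map INTO A TRIVIAL
REPRESENTATION — the situation axiomatised below as `(ρ, σ)` with `σ ∘ ρ g = σ` for all `g`. [Markman2025SecantWeil]
§1.5/§7.3 (the equivariant normalisation `t_x^* E ≅ E ⊗ P_x` and the descent to `(X × X̂)/Ḡ`) is the printed instance
with `Ḡ` a free translation group; the cell's family-B census (`target-g6/DETTWIST-G6-t12.md` §1.1–1.2) already decides
«SEMIREG = σ injective on `Ext²(E,E)^G`». What is recorded here is the complementary half, used by the note for EVERY
Brauer class at once.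

CONTENT (all PROVED, 0 sorry, no definitions, no named facts). `k` a commutative ring with `|G|` invertible, `ρ` a
`k`-linear representation of the finite group `G` on `V`, `σ : V →ₗ[k] W` with `σ ∘ₗ ρ g = σ` for every `g`:
* `averageMap_apply_eq_sum` — Mathlib's `Representation.averageMap` is `v ↦ ⅟|G| • ∑_g ρ g v`;
* `comp_averageMap_eq` — `σ ∘ (Reynolds projector) = σ`: **`σ` only sees the invariant part**;
* `map_sub_averageMap_eq_zero`, `map_sub_eq_zero` — `σ(v − R v) = 0`, `σ(ρ g v − v) = 0`: the non-invariant part is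
  AUTOMATICALLY in `ker σ`;
* `range_eq_map_invariants` — `range σ = σ(V^G)`; over a field with `V` finite-dimensional,
  `finrank_range_le_finrank_invariants` — **rank law `rank σ ≤ dim V^G`** (the cell's COUNT laws for a twisted object are
  to be read with `dim Ext²(N,N)^G`, not `dim Ext²(N,N)`), and `finrank_add_finrank_ker_le` —
  `dim V ≤ dim V^G + dim ker σ`;
* `invariants_eq_top_of_injective`, `injective_iff_invariants_eq_top_and_injOn` — **`σ` injective on `V` ⟺ `G` acts
  trivially on `V` and `σ` is injective on `V^G`**: an honest sheaf `N` upstairs is semiregular iff its twisted descent `E`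
  is semiregular AND `G` acts trivially on `Ext²(N,N)`; the twisted door is never narrower than the untwisted one on the
  cover and is wider exactly by the non-invariant isotypic part.
Deliberately NOT here: any statement about sheaves, gerbes, Brauer groups or Hodge cohomology (no carrier in the tree for
twisted sheaves; the geometric identification above is the note's DERIVED-ELEMENTARY step, inputs [Markman2025SecantWeil]
§7.3, [BuchweitzFlenner2003] §3–§5 naturality of `At`, Mumford's theta groups).
-/

noncomputable section

open Representation

namespace Summit.Ventures.HSemireg

namespace EquivariantSigma

variable {k G V W : Type*} [CommRing k] [Group G] [AddCommGroup V] [Module k V] [AddCommGroup W] [Module k W]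
variable [Fintype G] [Invertible (Fintype.card G : k)]
variable (ρ : Representation k G V) (σ : V →ₗ[k] W)

/-- Mathlib's Reynolds operator `Representation.averageMap ρ` (the action of `⅟|G| • ∑_g g ∈ k[G]`) evaluated on a
vector: `R v = ⅟|G| • ∑_g ρ g v`. Folklore (Maschke averaging). -/
theorem averageMap_apply_eq_sum (v : V) :
    ρ.averageMap v = ⅟(Fintype.card G : k) • ∑ g : G, ρ g v := by
  simp only [averageMap, GroupAlgebra.average, map_smul, map_sum, asAlgebraHom_of,
    LinearMap.smul_apply, LinearMap.coe_sum, Finset.sum_apply]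

variable {ρ σ}

omit [Invertible (Fintype.card G : k)] in
/-- **Orbit sums.** If `σ ∘ ρ g = σ` for all `g` (an equivariant map into a trivially acted module), then
`σ (∑_g ρ g v) = |G| • σ v`. Folklore. -/
theorem map_sum_eq_card_smul (hσ : ∀ g : G, σ ∘ₗ ρ g = σ) (v : V) :
    σ (∑ g : G, ρ g v) = (Fintype.card G : k) • σ v := by
  have h : ∀ g : G, σ (ρ g v) = σ v := fun g => by
    simpa using LinearMap.congr_fun (hσ g) v
  simp only [map_sum, h, Finset.sum_const, Finset.card_univ, Nat.cast_smul_eq_nsmul]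

/-- **`σ` only sees the invariant part**: an equivariant linear map into a trivially acted module factors through
the Reynolds projector, `σ ∘ R = σ`. (THEOREM TW-EQ (iv) of the seat note, abstract form.) Folklore. -/
theorem comp_averageMap_eq (hσ : ∀ g : G, σ ∘ₗ ρ g = σ) : σ ∘ₗ ρ.averageMap = σ := by
  ext v
  rw [LinearMap.comp_apply, averageMap_apply_eq_sum, map_smul, map_sum_eq_card_smul hσ, smul_smul,
    invOf_mul_self, one_smul]

/-- Pointwise form of `comp_averageMap_eq`: `σ (R v) = σ v`. Folklore. -/
theorem map_averageMap_eq (hσ : ∀ g : G, σ ∘ₗ ρ g = σ) (v : V) : σ (ρ.averageMap v) = σ v :=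
  LinearMap.congr_fun (comp_averageMap_eq hσ) v

/-- **The non-invariant part lies in the kernel**: `σ (v − R v) = 0` for every `v` (and `v − R v` ranges over the
complement `ker R` of the invariants `V^G = range R`). Folklore. -/
theorem map_sub_averageMap_eq_zero (hσ : ∀ g : G, σ ∘ₗ ρ g = σ) (v : V) : σ (v - ρ.averageMap v) = 0 := by
  rw [map_sub, map_averageMap_eq hσ, sub_self]

omit [Fintype G] [Invertible (Fintype.card G : k)] in
/-- `σ (ρ g v − v) = 0`: every «`g`-coboundary» is killed by `σ`. Folklore. -/
theorem map_sub_eq_zero (hσ : ∀ g : G, σ ∘ₗ ρ g = σ) (g : G) (v : V) : σ (ρ g v - v) = 0 := by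
  have := LinearMap.congr_fun (hσ g) v
  simp only [LinearMap.comp_apply] at this
  rw [map_sub, this, sub_self]

/-- The kernel of the Reynolds projector (the non-invariant isotypic part) is contained in `ker σ`. Folklore. -/
theorem ker_averageMap_le_ker (hσ : ∀ g : G, σ ∘ₗ ρ g = σ) :
    LinearMap.ker ρ.averageMap ≤ LinearMap.ker σ := by
  intro v hv
  rw [LinearMap.mem_ker] at hv ⊢
  rw [← map_averageMap_eq hσ v, hv, map_zero]

/-- **`range σ = σ(V^G)`**: the image of an equivariant map into a trivially acted module is the image of the
invariants alone. Folklore. -/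
theorem range_eq_map_invariants (hσ : ∀ g : G, σ ∘ₗ ρ g = σ) :
    LinearMap.range σ = (invariants ρ).map σ := by
  apply le_antisymm
  · rintro w ⟨v, rfl⟩
    exact ⟨ρ.averageMap v, ρ.averageMap_invariant v, map_averageMap_eq hσ v⟩
  · exact LinearMap.map_le_range

omit [Fintype G] [Invertible (Fintype.card G : k)] in
/-- **An injective equivariant map into a trivially acted module forces the action to be trivial**: if `σ` is
injective then every vector is invariant, `V^G = V`. (An honest sheaf upstairs that is semiregular has `G` acting
trivially on its `Ext²`.) Folklore. -/
theorem invariants_eq_top_of_injective (hσ : ∀ g : G, σ ∘ₗ ρ g = σ) (hinj : Function.Injective σ) :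
    invariants ρ = ⊤ := by
  rw [eq_top_iff]
  intro v _
  rw [mem_invariants]
  intro g
  have h0 := map_sub_eq_zero hσ g v
  rw [← map_zero σ] at h0
  exact sub_eq_zero.mp (hinj h0)

omit [Fintype G] [Invertible (Fintype.card G : k)] in
/-- **`σ` injective on `V` ⟺ `G` acts trivially on `V` and `σ` is injective on the invariants.** (Upstairs /
downstairs dictionary: `N` semiregular on the cover ⟺ its twisted descent `E` semiregular AND `Ext²(N,N)^G = Ext²(N,N)`.)
Folklore. -/
theorem injective_iff_invariants_eq_top_and_injOn (hσ : ∀ g : G, σ ∘ₗ ρ g = σ) :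
    Function.Injective σ ↔
      invariants ρ = ⊤ ∧ Function.Injective (σ.domRestrict (invariants ρ)) := by
  constructor
  · intro hinj
    refine ⟨invariants_eq_top_of_injective hσ hinj, ?_⟩
    intro x y hxy
    apply Subtype.ext
    exact hinj (by simpa using hxy)
  · rintro ⟨htop, hinj⟩ x y hxy
    have hx : x ∈ invariants ρ := htop ▸ Submodule.mem_top
    have hy : y ∈ invariants ρ := htop ▸ Submodule.mem_top
    have := @hinj ⟨x, hx⟩ ⟨y, hy⟩ (by simpa using hxy)
    exact congrArg Subtype.val this

end EquivariantSigma

namespace EquivariantSigma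

/-! ### Rank laws over a field (the cell's COUNT currency) -/

variable {k G V W : Type*} [Field k] [Group G] [AddCommGroup V] [Module k V] [AddCommGroup W] [Module k W]
variable [Fintype G] [Invertible (Fintype.card G : k)]
variable {ρ : Representation k G V} {σ : V →ₗ[k] W}

/-- **Rank law**: `rank σ ≤ dim V^G` for an equivariant map into a trivially acted module (finite-dimensional `V`
over a field). For a twisted object the COUNT laws of the cell are therefore read with the dimension of the INVARIANT
part of `Ext²` of the cover sheaf. Folklore. -/
theorem finrank_range_le_finrank_invariants [FiniteDimensional k V] (hσ : ∀ g : G, σ ∘ₗ ρ g = σ) :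
    Module.finrank k (LinearMap.range σ) ≤ Module.finrank k (invariants ρ) := by
  rw [range_eq_map_invariants hσ]
  exact Submodule.finrank_map_le σ (invariants ρ)

/-- **Kernel law**: `dim V ≤ dim V^G + dim ker σ`, i.e. `dim ker σ ≥ dim V − dim V^G` (the whole non-invariant part
is kernel). Folklore (rank–nullity + the rank law). -/
theorem finrank_le_finrank_invariants_add_finrank_ker [FiniteDimensional k V] (hσ : ∀ g : G, σ ∘ₗ ρ g = σ) :
    Module.finrank k V ≤ Module.finrank k (invariants ρ) + Module.finrank k (LinearMap.ker σ) := by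
  have h := LinearMap.finrank_range_add_finrank_ker σ
  have h' := finrank_range_le_finrank_invariants hσ
  omega

omit [Fintype G] [Invertible (Fintype.card G : k)] in
/-- **Injectivity needs the full count on the invariants**: if `σ` is injective then `dim V = dim V^G`
(finite-dimensional `V` over a field). Folklore. -/
theorem finrank_eq_finrank_invariants_of_injective [FiniteDimensional k V] (hσ : ∀ g : G, σ ∘ₗ ρ g = σ)
    (hinj : Function.Injective σ) : Module.finrank k V = Module.finrank k (invariants ρ) := by
  rw [invariants_eq_top_of_injective hσ hinj, finrank_top]

end EquivariantSigma

end Summit.Ventures.HSemireg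

end
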